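import Literature.NumberTheory.EllipticCurves.KatoAdditiveTwistedValueNeronIntegralityThree
import Literature.NumberTheory.EllipticCurves.GaussianLatticeThirdValues
import Literature.NumberTheory.EllipticCurves.GaussianLatticeFifthDivision
import Literature.NumberTheory.EllipticCurves.GaussianLatticeHeckeLValue
import Literature.NumberTheory.EllipticCurves.WeierstrassPMultiplication
import HarnessLib

/-!
# STUB-PLAN for `stub_neronIntegralThreeQuartic` (C⁺_quartic) of the line of record `rubin_e1_inert_three`
# (crux `InertBadAtThree`, stmt-BirchSwinnertonDyer-19225) — ideator bsd-idea-18 g8, lens = transfer (publish-only)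

BSD is NOT proved here; crux 19225 is NOT closed; NO stub of the registered skeleton (v4 d5de30f38debde80) is proved by this
file.  This is a typed decomposition of the registered stub `RubinE1InertThree.stub_neronIntegralThreeQuartic` into
formalisation-sized pieces, every piece a `theorem stub_… := by sorry` over EXISTING declarations, plus the sorry-free
compositions.  It supersedes the g7 scheme (EPSILON-RESOLVED §8: 𝔞-smoothing F3, Lubin–Tate/formal-group F4, orthogonality F5)
by two CLOSED-FORM identities for the quartic-character-twisted `3`-torsion sums of `E₁*` on `Λ = ℤi + ℤ`, siblings of the
tree theorem `GaussianLattice.kroneckerE₁_twisted_three_torsion_sum` (the `κ`-twisted sum, used for `L(E₃,1) = β/√3`):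

  `∑_v χ₄(3v) E₁*(w+v) = 6(√3 − 1) ℘(1/3) (℘(w)² + ϖ₀⁴) ℘'(w) / D(w)`        (3-adic order of the constant: 3/4)
  `∑_v χ̄₄(3v) E₁*(w+v) = 2(3 − √3) ℘(1/3) (3℘(w)² − ϖ₀⁴) ℘'(w) / D(w)`       (3-adic order of the constant: 1/4)
  `∑_v κ(3v)  E₁*(w+v) = 8√3 ϖ₀⁴ ℘(w) ℘'(w) / D(w)`  (tree)                  (3-adic order of the constant: 1/2)

(`χ₄ = (·/3)₄`: `±1 ↦ 1, ±i ↦ −1, ±(1+i) ↦ −i, ±(1−i) ↦ i`; `D(w) = 3℘⁴ − 6ϖ₀⁴℘² − ϖ₀⁸ ≡ −ϖ₀⁸` a `3`-unit on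
prime-to-`3` torsion; numerically certified to 4·10⁻¹⁴ at 8 random `w`, g8/closed_forms_check.py).  These are exactly the
deficits `1 − k/4` (`k = v₃(D) = 1, 3, 2`) that the factor `|D|^{1/4}/M`, `M = 3M'`, of the finite formula loses; with the
`3`-integrality of prime-to-`3` torsion coordinates on `y² = x³ − x` (division polynomials, in the tree) the Néron
`3`-integrality follows with NO Shimura reciprocity, NO formal groups, NO smoothing.  Printed inputs: all PROVED in the tree
(Ireland–Rosen Ch. 18 Thm 5 `IrelandRosen1990_card_points_one_mod_four_holds`, Thm 7 `QuarticTwistHeckeCharacter` /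
`QuarticTwistEulerFactors`, biquadratic reciprocity + supplements, `GaussianLattice.thetaLFunction_one_eq_sum_kroneckerE₁`,
`PeriodPair.weierstrassP_int_mul_mul_ΨSq`, `GaussianLattice.weierstrassP_one_add_I_mul`, `weierstrassP_third_sq`,
`weierstrassP_one_add_I_third_sq`, `kroneckerE₁_add_add_sub`, Birch `ModularSymbols.twisted_LValue_eq_holds`).

Pieces (sizes): P0 `stub_peel` (S) · P1a `stub_quarticModel` (M) · P1b `stub_quarticThetaDictionary` (L, template = the
`D = n²` files `CongruentNumberCurveHeckeSeries`/`…LSeriesProofs`) · P2 `stub_quarticPeriods` (M) · P4.0 `stub_third_mul_diag_third`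
(S) · P4.1/P4.2 `stub_quarticSum_eq` / `stub_quarticConjSum_eq` (M each, template = the tree's κ proof) · P4.3/P4.4 exact quarter values (S, falsifiers) · P5
`stub_torsion_coord_isIntegral` (M) · P6 `stub_clean_of_dictionary` (L: CRT split of the finite formula + valuation
bookkeeping, uses P4/P5 and the three `…_threeIntegral` corollaries) — compositions `cleanNeronIntegralThreeQuartic_of_plan`,
`neronIntegralThreeQuartic_of_plan` are sorry-free.
-/

noncomputable section

open scoped MatrixGroups ModularForm Real PeriodPair ComplexConjugate
open Complex PeriodPair CongruenceSubgroup Literature.NumberTheory.EllipticCurves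
open Literature.NumberTheory.EllipticCurves.ModularForms Literature.NumberTheory.EllipticCurves.GaussianLattice

namespace Summit.BirchSwinnertonDyer.BirchSwinnertonDyer.Cruxes.InertBadAtThree.RubinE1InertThree.QuarticPlan

local notation "Λᵢ" => PeriodPair.ofUpperHalfPlane UpperHalfPlane.I

local notation "ϖ₀" => (Real.Gamma (1 / 4) ^ 2 / (2 * Real.sqrt (2 * π)) : ℝ)

/-! ## The registered stub's body (VERBATIM restatement of `RubinE1InertThree.NeronIntegralThreePolarAt` /
`NeronIntegralThreeQuartic`, Lines/rubin_e1_inert_three.lean ll. 143–178; Lines files are not importable) -/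

/-- F-es-18's pointwise body at `V` (verbatim copy of `RubinE1InertThree.NeronIntegralThreePolarAt`). -/
def NeronIntegralThreePolarAt (V : WeierstrassCurve ℚ) [V.IsElliptic] [V.IsGloballyMinimal] : Prop :=
  ∀ {N : ℕ} [NeZero N]
    (f : CuspForm (Gamma0 N) 2) (_ : IsNewformOf V f)
    (_ : ¬ V.HasGoodReductionAtPrime 3) (_ : ¬ V.HasMultiplicativeReductionAtPrime 3)
    (_ : V.HasIrreducibleModPGaloisRep 3) (m : ℕ) [NeZero m] (_ : m.Coprime (3 * N))
    (χ : DirichletCharacter ℂ m) (_ : χ.IsPrimitive) (_ : χ ≠ 1) (_ : ¬ 3 ∣ orderOf χ)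
    (_ : χ (3 : ZMod m) ≠ 1) (_ : χ (3 : ZMod m) ≠ -1) (ϖ : ℚ) (r : ℂ),
    (χ.Even → (ϖ : ℝ) * V.realPeriodRat = plusPeriod f →
      (∏ ℓ ∈ N.primeFactors with ¬ ℓ ^ 2 ∣ N,
          (((ℓ : ℂ) - (V.LFunction ℓ : ℂ) * χ (ℓ : ZMod m)) *
            ((ℓ : ℂ) - (V.LFunction ℓ : ℂ) * (χ (ℓ : ZMod m))⁻¹))) *
          twistedSymbolSum f χ = r * (plusPeriod f : ℂ) →
      ∃ s : ℕ, ¬ 3 ∣ s ∧ IsIntegral ℤ ((s : ℂ) * ϖ * r)) ∧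
    (χ.Odd → (ϖ : ℝ) * V.imaginaryPeriodRat = minusPeriod f →
      (∏ ℓ ∈ N.primeFactors with ¬ ℓ ^ 2 ∣ N,
          (((ℓ : ℂ) - (V.LFunction ℓ : ℂ) * χ (ℓ : ZMod m)) *
            ((ℓ : ℂ) - (V.LFunction ℓ : ℂ) * (χ (ℓ : ZMod m))⁻¹))) *
          twistedSymbolSum f χ = r * (minusPeriod f : ℂ) * Complex.I →
      ∃ s : ℕ, ¬ 3 ∣ s ∧ IsIntegral ℤ ((s : ℂ) * ϖ * r))

/-- C⁺_quartic (verbatim copy of `RubinE1InertThree.NeronIntegralThreeQuartic` = the registered stub's statement). -/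
def NeronIntegralThreeQuartic : Prop :=
  ∀ (V : WeierstrassCurve ℚ) [V.IsElliptic] [V.IsGloballyMinimal],
    V.j = 1728 → ¬ V.HasGoodReductionAtPrime 3 → NeronIntegralThreePolarAt V

/-! ## P0 — the PEEL: clean currency `τ(χ)L(V,χ̄,1)/Ω^±(V)` (Birch: `twistedSymbolSum f χ = τ(χ) L(f, χ⁻¹, 1)`,
`ModularSymbols.twisted_LValue_eq_holds`); the Euler factors at `ℓ ∥ N` are algebraic integers (empty for CM anyway,
`not_hasMultiplicativeReductionAtPrime_of_hasCM`), `ϖ` cancels (`realPeriodRat_pos_holds`, `imaginaryPeriodRat_pos`). -/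

/-- (T_clean) at `V`: same binders as the stub, conclusion in the clean currency. -/
def CleanNeronIntegralThreePolarAt (V : WeierstrassCurve ℚ) [V.IsElliptic] [V.IsGloballyMinimal] : Prop :=
  ∀ {N : ℕ} [NeZero N]
    (f : CuspForm (Gamma0 N) 2) (_ : IsNewformOf V f)
    (_ : ¬ V.HasGoodReductionAtPrime 3) (_ : ¬ V.HasMultiplicativeReductionAtPrime 3)
    (_ : V.HasIrreducibleModPGaloisRep 3) (m : ℕ) [NeZero m] (_ : m.Coprime (3 * N))
    (χ : DirichletCharacter ℂ m) (_ : χ.IsPrimitive) (_ : χ ≠ 1) (_ : ¬ 3 ∣ orderOf χ)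
    (_ : χ (3 : ZMod m) ≠ 1) (_ : χ (3 : ZMod m) ≠ -1),
    (χ.Even → ∃ s : ℕ, ¬ 3 ∣ s ∧ IsIntegral ℤ ((s : ℂ) * twistedSymbolSum f χ / (V.realPeriodRat : ℂ))) ∧
    (χ.Odd → ∃ s : ℕ, ¬ 3 ∣ s ∧
      IsIntegral ℤ ((s : ℂ) * twistedSymbolSum f χ / ((V.imaginaryPeriodRat : ℂ) * Complex.I)))

/-- (T_clean) on the quartic cell. -/
def CleanNeronIntegralThreeQuartic : Prop :=
  ∀ (V : WeierstrassCurve ℚ) [V.IsElliptic] [V.IsGloballyMinimal],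
    V.j = 1728 → ¬ V.HasGoodReductionAtPrime 3 → CleanNeronIntegralThreePolarAt V

/-- **P0 `stub_peel` (S).** `ϖ · r = (∏_{ℓ ∥ N} …) · twistedSymbolSum f χ / Ω^±(V)` from the two hypotheses of each branch
(`Ω^±(V) > 0`: `realPeriodRat_pos_holds`, `imaginaryPeriodRat_pos`; if `ϖ = 0` the conclusion is `IsIntegral ℤ 0`), and the
Euler-factor product is an algebraic integer (`V.LFunction ℓ ∈ ℤ`, `χ(ℓ)`, `χ(ℓ)⁻¹` roots of unity), so `IsIntegral` is preserved
(`IsIntegral.mul`). [folklore] -/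
theorem stub_peel (V : WeierstrassCurve ℚ) [V.IsElliptic] [V.IsGloballyMinimal] :
    CleanNeronIntegralThreePolarAt V → NeronIntegralThreePolarAt V := by
  sorry

/-! ## P4 — the closed forms on `Λ = ℤi + ℤ` (`ϖ₀ = Γ(1/4)²/(2√(2π))`, `e₁ = ϖ₀²`, `g₂ = 4ϖ₀⁴`, `g₃ = 0`) -/

/-- The `χ₄`-twisted sum of `E₁*` over `E[3] ∖ 0`, `χ₄ = (·/3)₄` evaluated at `3v`:
`χ₄(±1) = 1`, `χ₄(±i) = −1`, `χ₄(±(1+i)) = −i`, `χ₄(±(1−i)) = i` (`(c/3)₄ ≡ c² (mod 3)`, `i mod 3 ↦ I`). -/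
def threeTorsionQuarticSum (w : ℂ) : ℂ :=
  kroneckerE₁ (w + 1 / 3) + kroneckerE₁ (w - 1 / 3) -
    (kroneckerE₁ (w + I / 3) + kroneckerE₁ (w - I / 3)) -
    I * (kroneckerE₁ (w + (1 + I) / 3) + kroneckerE₁ (w - (1 + I) / 3)) +
    I * (kroneckerE₁ (w + (1 - I) / 3) + kroneckerE₁ (w - (1 - I) / 3))

/-- The `χ̄₄`-twisted sum (`χ̄₄(±(1+i)) = i`, `χ̄₄(±(1−i)) = −i`). -/
def threeTorsionQuarticConjSum (w : ℂ) : ℂ :=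
  kroneckerE₁ (w + 1 / 3) + kroneckerE₁ (w - 1 / 3) -
    (kroneckerE₁ (w + I / 3) + kroneckerE₁ (w - I / 3)) +
    I * (kroneckerE₁ (w + (1 + I) / 3) + kroneckerE₁ (w - (1 + I) / 3)) -
    I * (kroneckerE₁ (w + (1 - I) / 3) + kroneckerE₁ (w - (1 - I) / 3))

/-- **P4.0 `stub_third_mul_diag_third` (S): `℘(1/3) · ℘((1+i)/3) = −i ϖ₀⁴/√3`** — complex multiplication by `1 + i`
(`GaussianLattice.weierstrassP_one_add_I_mul` at `u = 1/3`: `℘((1+i)/3) = −i(℘(1/3)² − ϖ₀⁴)/(2℘(1/3))`) and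
`℘(1/3)² = (3 + 2√3)ϖ₀⁴/3` (`weierstrassP_third_sq`).  Sign-free (only `℘(1/3)²` enters).  Numerically
`℘(1/3) = 10.0920153…`, `℘((1+i)/3) = −2.7041473… i`, product `−27.2902964… i` ✓. [folklore] -/
theorem stub_third_mul_diag_third :
    ℘[Λᵢ] (1 / 3) * ℘[Λᵢ] ((1 + I) / 3) = -I * ((ϖ₀ : ℝ) : ℂ) ^ 4 / (Real.sqrt 3 : ℂ) := by
  sorry

/-- **P4.1 `stub_quarticSum_eq` (M): the `χ₄`-twisted closed form.**  For `w ∉ Λ` with `D(w) ≠ 0`,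
`∑_v χ₄(3v) E₁*(w+v) = 6(√3 − 1) ℘(1/3) (℘(w)² + ϖ₀⁴) ℘'(w) / D(w)`.  Proof template = the tree's
`kroneckerE₁_twisted_three_torsion_sum`: pair `v` with `−v` by `kroneckerE₁_add_add_sub` (the `∑ χ₄ · E₁*(w)` terms cancel as
`∑ χ₄ = 0`), giving `2℘'(w)[P₁/(℘²−P₁²) − iP₂/(℘²−P₂²)]` with `P₁ = ℘(1/3)`, `P₂ = ℘((1+i)/3)` (`℘(i/3) = −P₁`,
`℘((1−i)/3) = −P₂`); then `P₁² , P₂²` (tree) and `P₁P₂ = −iϖ₀⁴/√3` (P4.0) turn the bracket into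
`(√3−1)P₁(℘² + ϖ₀⁴)·3/D`.  In coordinates `x = ℘/ϖ₀²`, `y = ℘'/(2ϖ₀³)` of `y² = x³ − x` this is
`S/ϖ₀ = 4√2·3^{3/4}(x²+1)y/(3x⁴−6x²−1)` — `3`-adic order of the constant `3/4`.  Certified numerically (err ≤ 4·10⁻¹⁴).
[folklore] -/
theorem stub_quarticSum_eq {w : ℂ} (hw : w ∉ (Λᵢ).lattice)
    (hD : 3 * ℘[Λᵢ] w ^ 4 - 6 * ((ϖ₀ : ℝ) : ℂ) ^ 4 * ℘[Λᵢ] w ^ 2 - ((ϖ₀ : ℝ) : ℂ) ^ 8 ≠ 0) :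
    threeTorsionQuarticSum w =
      6 * ((Real.sqrt 3 : ℂ) - 1) * ℘[Λᵢ] (1 / 3) * (℘[Λᵢ] w ^ 2 + ((ϖ₀ : ℝ) : ℂ) ^ 4) * ℘'[Λᵢ] w /
        (3 * ℘[Λᵢ] w ^ 4 - 6 * ((ϖ₀ : ℝ) : ℂ) ^ 4 * ℘[Λᵢ] w ^ 2 - ((ϖ₀ : ℝ) : ℂ) ^ 8) := by
  sorry

/-- **P4.2 `stub_quarticConjSum_eq` (M): the `χ̄₄`-twisted closed form.**
`∑_v χ̄₄(3v) E₁*(w+v) = 2(3 − √3) ℘(1/3) (3℘(w)² − ϖ₀⁴) ℘'(w) / D(w)`; in coordinates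
`S/ϖ₀ = 4√2·3^{1/4}(3x²−1)y/(3x⁴−6x²−1)` — `3`-adic order of the constant `1/4`.  Same proof. [folklore] -/
theorem stub_quarticConjSum_eq {w : ℂ} (hw : w ∉ (Λᵢ).lattice)
    (hD : 3 * ℘[Λᵢ] w ^ 4 - 6 * ((ϖ₀ : ℝ) : ℂ) ^ 4 * ℘[Λᵢ] w ^ 2 - ((ϖ₀ : ℝ) : ℂ) ^ 8 ≠ 0) :
    threeTorsionQuarticConjSum w =
      2 * (3 - (Real.sqrt 3 : ℂ)) * ℘[Λᵢ] (1 / 3) * (3 * ℘[Λᵢ] w ^ 2 - ((ϖ₀ : ℝ) : ℂ) ^ 4) * ℘'[Λᵢ] w /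
        (3 * ℘[Λᵢ] w ^ 4 - 6 * ((ϖ₀ : ℝ) : ℂ) ^ 4 * ℘[Λᵢ] w ^ 2 - ((ϖ₀ : ℝ) : ℂ) ^ 8) := by
  sorry

/-- **P4.3 `stub_quarticSum_quarter` (S; exact falsifier / first rung): `∑_v χ₄(3v)E₁*(1/4 + v) = −2·3^{3/4}·ϖ₀`**
(`x(1/4) = 1 + √2`, `y(1/4) = −√2(1+√2)`: `4√2(x²+1)y/(3x⁴−6x²−1) = −2`; numerically `−2.0000000000000 ± 1e-15`; sibling of the tree's
`twistedSum_quarter : threeTorsionTwistedSum (1/4) = −2√3ϖ₀`). [folklore] -/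
theorem stub_quarticSum_quarter :
    threeTorsionQuarticSum (1 / 4) = -2 * (3 : ℂ) ^ ((3 : ℂ) / 4) * ((ϖ₀ : ℝ) : ℂ) := by
  sorry

/-- **P4.4 `stub_quarticConjSum_quarter` (S): `∑_v χ̄₄(3v)E₁*(1/4 + v) = −2(1+√2)·3^{1/4}·ϖ₀`** (`4√2(3x²−1)y/(3x⁴−6x²−1) = −2(1+√2)` at
`x = 1+√2`; numerically ✓ 1e-15). [folklore] -/
theorem stub_quarticConjSum_quarter :
    threeTorsionQuarticConjSum (1 / 4) =
      -2 * (1 + (Real.sqrt 2 : ℂ)) * (3 : ℂ) ^ ((1 : ℂ) / 4) * ((ϖ₀ : ℝ) : ℂ) := by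
  sorry

/-! ## P5 — prime-to-`3` torsion of `y² = x³ − x` has `3`-integral coordinates (division polynomials) -/

/-- **P5 `stub_torsion_coord_isIntegral` (M).**  If `w ∉ Λ`, `n w ∈ Λ`, `n ≠ 0`, then `x(w) = ℘(w)/ϖ₀²` and
`y(w) = ℘'(w)/(2ϖ₀³)` (coordinates on `A : y² = x³ − x`, the curve of the lattice `ϖ₀Λ`, `g₂ = 4`, `g₃ = 0`) satisfy:
`n² x(w)` and `n³ y(w)` are algebraic integers.  Proof: `x(w)` is a root of Mathlib's `ΨSqₙ ∈ ℤ[X]` of `⟨0,0,0,−1,0⟩`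
(`PeriodPair.eval_ΨSq_weierstrassP_eq_zero_iff` / `aeval_ΨSq_of_map_eq_curve` on the rescaled lattice), whose leading
coefficient is `n²` (`WeierstrassCurve.leadingCoeff_ΨSq`), so `n² • x(w)` is integral (`isIntegral_leadingCoeff_smul`); and
`(n³y)² = (n²x)³ − n⁴(n²x)` (`IsIntegral.of_pow`).  (Silverman AEC VII.3.4 / Cassels 1949 is the local statement; not needed.)
[cite: SilvermanAEC2009, Exercise 3.7 (d),(f); Thm. VII.3.4] -/
theorem stub_torsion_coord_isIntegral {w : ℂ} {n : ℕ} (hw : w ∉ (Λᵢ).lattice)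
    (hn : ((n : ℂ) * w) ∈ (Λᵢ).lattice) (hn0 : n ≠ 0) :
    IsIntegral ℤ (((n : ℂ) ^ 2) * (℘[Λᵢ] w / ((ϖ₀ : ℝ) : ℂ) ^ 2)) ∧
      IsIntegral ℤ (((n : ℂ) ^ 3) * (℘'[Λᵢ] w / (2 * ((ϖ₀ : ℝ) : ℂ) ^ 3))) := by
  sorry

/-! ## P6a–c — the (R) table as statements: `3`-adic order of the twisted torsion sums on prime-to-`3` torsion
(corollaries of P4.1/P4.2/the tree's κ form + P5 + «`3X⁴ − 6n⁴X² − n⁸ ≡ −n⁸` is prime to `3`, so its norm `s` works»).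
Currency: `∃ s ∈ ℕ, 3 ∤ s, IsIntegral ℤ (s · X)` ⟺ the algebraic number `X` is integral at every prime above `3`. -/

/-- **P6a (M, from P4.1 + P5): `k = 1` cell — `∑_v χ₄(3v)E₁*(w+v) / (ϖ₀ · 3^{3/4})` is `3`-integral.** [folklore] -/
theorem stub_quarticSum_threeIntegral {w : ℂ} {n : ℕ} (hw : w ∉ (Λᵢ).lattice)
    (hn : ((n : ℂ) * w) ∈ (Λᵢ).lattice) (h3 : ¬ 3 ∣ n) :
    ∃ s : ℕ, ¬ 3 ∣ s ∧
      IsIntegral ℤ ((s : ℂ) * threeTorsionQuarticSum w / (((ϖ₀ : ℝ) : ℂ) * (3 : ℂ) ^ ((3 : ℂ) / 4))) := by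
  sorry

/-- **P6b (M, from P4.2 + P5): `k = 3` cell — `∑_v χ̄₄(3v)E₁*(w+v) / (ϖ₀ · 3^{1/4})` is `3`-integral.** [folklore] -/
theorem stub_quarticConjSum_threeIntegral {w : ℂ} {n : ℕ} (hw : w ∉ (Λᵢ).lattice)
    (hn : ((n : ℂ) * w) ∈ (Λᵢ).lattice) (h3 : ¬ 3 ∣ n) :
    ∃ s : ℕ, ¬ 3 ∣ s ∧
      IsIntegral ℤ ((s : ℂ) * threeTorsionQuarticConjSum w / (((ϖ₀ : ℝ) : ℂ) * (3 : ℂ) ^ ((1 : ℂ) / 4))) := by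
  sorry

/-- **P6c (S, from the tree's `kroneckerE₁_twisted_three_torsion_sum` + P5): `k = 2` cell —
`∑_v κ(3v)E₁*(w+v) / (ϖ₀ · √3)` is `3`-integral** (`16√3·xy/(3x⁴−6x²−1)`). [folklore] -/
theorem stub_kappaSum_threeIntegral {w : ℂ} {n : ℕ} (hw : w ∉ (Λᵢ).lattice)
    (hn : ((n : ℂ) * w) ∈ (Λᵢ).lattice) (h3 : ¬ 3 ∣ n) :
    ∃ s : ℕ, ¬ 3 ∣ s ∧
      IsIntegral ℤ ((s : ℂ) * threeTorsionTwistedSum w / (((ϖ₀ : ℝ) : ℂ) * (Real.sqrt 3 : ℂ))) := by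
  sorry

/-! ## P1/P2 — the dictionary (Ireland–Rosen Ch. 18 Thms 5 & 7, PROVED in the tree: `EllipticCurveJ1728PointCount`,
`QuarticTwistHeckeCharacter`, `QuarticTwistEulerFactors`, `BiquadraticReciprocity*`; to be pushed into the concrete theta
language of `LFunctions.GaussianThetaSeries` exactly as the `D = n²` files `CongruentNumberCurveHeckeSeries` /
`CongruentNumberCurveLSeriesProofs` do for `heckePsi n`) -/

/-- The quartic residue symbol `(c/3)₄` (`≡ c² (mod 3)`, the unit `i^j ≡ c²` read in `ℂ`): `0` on `3 ∣ c`,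
`1` on `±1`, `−1` on `±i`, `−i` on `±(1+i)`, `i` on `±(1−i)` (mod `3`). -/
def quarticCharThree (c : GaussianInt) : ℂ :=
  if (3 : ℤ) ∣ c.re ∧ (3 : ℤ) ∣ c.im then 0
  else if (3 : ℤ) ∣ c.im then 1
  else if (3 : ℤ) ∣ c.re then -1
  else if (3 : ℤ) ∣ c.re - c.im then -I
  else I

/-- **P1a `stub_quarticModel` (M): the quartic cell is the family `y² = x³ − Dx`, `3 ∣ D`, `D` fourth-power-free.**
A globally minimal `V/ℚ` with `j = 1728` bad at `3` is `ℚ`-isomorphic to `⟨0,0,0,−D,0⟩` for a (unique) fourth-power-free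
`D ∈ ℤ ∖ 0` with `3 ∣ D` (`j = 1728 ⟺ c₆ = 0`; bad at `3` on the minimal model ⟺ `v₃(D) ∈ {1,2,3}`). [folklore] -/
theorem stub_quarticModel (V : WeierstrassCurve ℚ) [V.IsElliptic] [V.IsGloballyMinimal]
    (hj : V.j = 1728) (hbad : ¬ V.HasGoodReductionAtPrime 3) :
    ∃ (D : ℤ) (e : WeierstrassCurve.VariableChange ℚ), D ≠ 0 ∧ (3 : ℤ) ∣ D ∧
      (∀ p : ℕ, p.Prime → ¬ ((p : ℤ) ^ 4 ∣ D)) ∧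
      V = e • (⟨0, 0, 0, -(D : ℚ), 0⟩ : WeierstrassCurve ℚ) := by
  sorry

/-- **P2 `stub_quarticPeriods` (M): Néron periods of the quartic cell.**  For `V ≅ y² = x³ − Dx` globally minimal:
`Ω⁺(V) = 2^a (√2)^ε ϖ₀ |D|^{−1/4}` and `|Ω⁻(V)| = 2^{a'} (√2)^{ε'} ϖ₀ |D|^{−1/4}` with `a, a' ∈ ℤ`, `ε, ε' ∈ {0,1}`
(`Λ(E_D) = D^{−1/4}Λ(E₁)`, `Λ(E₁) = ϖ₀Λᵢ`, `Ω(E₁) = 2ϖ₀`, `Ω(E₋₁) = √2 ϖ₀`; minimalisation at `2` rescales by `2^j`).  Only the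
factor `|D|^{−1/4}` (3-adic order `−k/4`) matters at `3`. [folklore] -/
theorem stub_quarticPeriods (V : WeierstrassCurve ℚ) [V.IsElliptic] [V.IsGloballyMinimal] {D : ℤ}
    (e : WeierstrassCurve.VariableChange ℚ) (hD : D ≠ 0)
    (hV : V = e • (⟨0, 0, 0, -(D : ℚ), 0⟩ : WeierstrassCurve ℚ)) :
    (∃ (a : ℤ) (ε : ℕ), ε ≤ 1 ∧
        V.realPeriodRat = 2 ^ a * Real.sqrt 2 ^ ε * ϖ₀ * |(D : ℝ)| ^ (-(1 / 4 : ℝ))) ∧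
      (∃ (a : ℤ) (ε : ℕ), ε ≤ 1 ∧
        V.imaginaryPeriodRat = 2 ^ a * Real.sqrt 2 ^ ε * ϖ₀ * |(D : ℝ)| ^ (-(1 / 4 : ℝ))) := by
  sorry

/-- **P1b `stub_quarticThetaDictionary` (L): `L(V ⊗ χ̄, s) = ¼ Θ-L_{3M'}(χ̄₄^k · Ψ')(s)` with the `3`-part split off.**
For `V ≅ y² = x³ − Dx` (`D = ±3^k D₁`, `3 ∤ D₁`, `k ∈ {1,2,3}`), its newform `f`, and a primitive `χ` mod `m` prime to `3N`:
the twisted `L`-series `L(f, χ⁻¹, s) = Σ χ̄(n) aₙ n^{−s}` (`re s > 2`) is `¼ Σ_{x ∈ ℤ[i]} Ψ(x) x N(x)^{−s}`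
(`LFunctions.GaussianTheta.thetaLFunction_eq_LSeries`) for `Ψ(x) = conj((D/x̃)₄)·primaryUnit(x)·χ̄(N x)`
(Ireland–Rosen 18.5/18.7: `χ_D(π) = conj((D/π)₄) π`, tree `QuarticTwistEulerFactors`), and the `3`-part of `Ψ` is
`conj((x/3)₄)^k = χ̄₄(x)^k` (biquadratic reciprocity for the primary prime `−3`, `N(−3) = 9`: `(−3/x̃)₄ = (x̃/3)₄`; the unit
`(−1/x̃)₄^k`, `χ₄(primaryUnit x)^k`, `(D₁/x̃)₄`, `primaryUnit`, `χ̄ ∘ N` are periodic modulo an `M'` with `3 ∤ M'`, `4 ∣ M'`).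
The net assignment `k = 1 ↦ χ̄₄` on `Ψ` (hence `χ₄` on the `E₁*`-sum after `E₁*(c̄/M)` and the CRT shift, P6) is the one
forced by the E3 numerics (0/52 violations, tight units at `k = 3`) and agrees with the printed conj placement. [cite: IrelandRosen1990, Ch. 18 §4 Thm 5, §6 Thm 7] -/
theorem stub_quarticThetaDictionary (V : WeierstrassCurve ℚ) [V.IsElliptic] [V.IsGloballyMinimal] {D : ℤ}
    (e : WeierstrassCurve.VariableChange ℚ) (hD : D ≠ 0) (h3 : (3 : ℤ) ∣ D)
    (h4 : ∀ p : ℕ, p.Prime → ¬ ((p : ℤ) ^ 4 ∣ D))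
    (hV : V = e • (⟨0, 0, 0, -(D : ℚ), 0⟩ : WeierstrassCurve ℚ))
    {N : ℕ} [NeZero N] (f : CuspForm (Gamma0 N) 2) (hf : IsNewformOf V f)
    (m : ℕ) [NeZero m] (hm : m.Coprime (3 * N)) (χ : DirichletCharacter ℂ m) (hχ : χ.IsPrimitive) :
    ∃ (M' : ℕ) (_ : NeZero (3 * M')) (Ψ' : GaussianInt → ℂ),
      ¬ 3 ∣ M' ∧ 4 ∣ M' ∧ m ∣ M' ∧
      (∀ x y : GaussianInt, Ψ' (x + (M' : GaussianInt) * y) = Ψ' x) ∧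
      (∀ x : GaussianInt, IsIntegral ℤ (Ψ' x)) ∧
      (∀ s : ℂ, 2 < s.re →
        twistedLSeries f χ⁻¹ s =
          (1 / 4 : ℂ) * Literature.NumberTheory.LFunctions.GaussianTheta.thetaLFunction (3 * M')
            (fun x ↦ (starRingEnd ℂ (quarticCharThree x)) ^ (padicValInt 3 D) * Ψ' x) s) := by
  sorry

/-! ## P6 — assembly: Birch + dictionary + finite formula + CRT + closed forms + torsion integrality ⇒ (T_clean) -/

/-- **P6 `stub_clean_of_dictionary` (L): the valuation bookkeeping.**  Given P1a/P1b/P2 at `V`: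
`twistedSymbolSum f χ = τ(χ) L(f, χ⁻¹, 1)` (Birch, `ModularSymbols.twisted_LValue_eq_holds`, with the entire continuation
`¼ Θ-L`, `LFunctions.GaussianTheta.differentiable_thetaLFunction`); `Θ-L_M(Ψ)(1) = M⁻¹ Σ_{c mod M} Ψ(c) E₁*(c̄/M)`
(`GaussianLattice.thetaLFunction_one_eq_sum_kroneckerE₁`, `M = 3M'`); CRT `c ↔ (c mod 3, c mod M')` with `1 = αM' + 3β`
(`α, β ∈ ℤ`): `E₁*(c̄/M) = E₁*(βc̄'/M' + αc̄₃/3)`, so the sum is `Σ_{c'} Ψ'(c') χ₄(α)^{k} · S_k(w_{c'})` with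
`S_1 = threeTorsionQuarticSum`, `S_2 = threeTorsionTwistedSum`, `S_3 = threeTorsionQuarticConjSum` (`χ̄₄ ∘ conj = χ₄`) and
`w_{c'} = βc̄'/M'`, `M' w_{c'} ∈ Λ`, `w_{c'} ∉ Λ` for `c'` prime to `M'` (else `Ψ' = 0`); P6a–c give order `≥ 1 − k/4` termwise,
`τ(χ)` is a `3`-unit (`τ(χ)τ(χ̄) = χ(−1) m`), `1/M` costs `1`, `Ω^±(V)⁻¹` gains `k/4` (P2) — total `≥ 0`, i.e. (T_clean).
[folklore] -/
theorem stub_clean_of_dictionary (V : WeierstrassCurve ℚ) [V.IsElliptic] [V.IsGloballyMinimal]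
    (hj : V.j = 1728) (hbad : ¬ V.HasGoodReductionAtPrime 3) :
    CleanNeronIntegralThreePolarAt V := by
  sorry

/-- Composition (sorry-free): (T_clean) on the quartic cell. -/
theorem cleanNeronIntegralThreeQuartic_of_plan : CleanNeronIntegralThreeQuartic :=
  fun V _ _ hj hbad ↦ stub_clean_of_dictionary V hj hbad

/-- Composition (sorry-free): the registered stub's statement `NeronIntegralThreeQuartic` from the plan
(P6 then P0).  A `Theorems/` closer repeating this with the pieces proved closes `stub_neronIntegralThreeQuartic` by name. -/
theorem neronIntegralThreeQuartic_of_plan : NeronIntegralThreeQuartic :=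
  fun V _ _ hj hbad ↦ stub_peel V (stub_clean_of_dictionary V hj hbad)

/-- The plan's contract in one line: PEEL ∘ (T_clean). -/
theorem neronIntegralThreeQuartic_of_clean (hpeel : ∀ (V : WeierstrassCurve ℚ) [V.IsElliptic] [V.IsGloballyMinimal],
      CleanNeronIntegralThreePolarAt V → NeronIntegralThreePolarAt V)
    (hclean : CleanNeronIntegralThreeQuartic) : NeronIntegralThreeQuartic :=
  fun V _ _ hj hbad ↦ hpeel V (hclean V hj hbad)

end Summit.BirchSwinnertonDyer.BirchSwinnertonDyer.Cruxes.InertBadAtThree.RubinE1InertThree.QuarticPlan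

end
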